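import Mathlib
import HarnessLib

/-!
# Venture HSemireg — the index-rank determinant lemma for the fibre-test cubic form

HONEST FRAMING. Lean leaf for the computation cell `pub-hsemireg` (theory seat th-3 gen 38; file of record
`run/shared/lean/pub/pub-hsemireg/theory/TH3-UNIVERSAL.md` §8–§8′, 2026-08-25). In the cell's fibre-test model
the cubic form is `T(r,r′,r″) = Σ_σ sgn σ · r_{σ1} r′_{σ2} r″_{σ3}` for three «rotation» triples `r, r′, r″` of
operators. The note's conjecture (IR′) says that on the end levels of a curved pencil summand of a simple
configuration all rotation triples have INDEX RANK ≤ 2, i.e. every triple is of the form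
`r_i = a_i • X + b_i • Y` for two FIXED index vectors `a, b ∈ k³` (and triple-dependent operators `X, Y`). THIS
FILE kernel-checks the purely algebraic consequence used there («determinant lemma»): for such triples
`T(r,r′,r″) = 0` identically, in any (associative, unital) algebra `A` over a commutative ring `k` — each of the
eight operator words `X X′ X″, X X′ Y″, …` collects as coefficient the determinant of a 3 × 3 matrix with two
equal rows. The six signed words of `T` are written out explicitly (indices `0,1,2`). Nothing here proves (IR′)
or (W³)₄; no object on an abelian variety is constructed; nothing here bears on HC, HC_CM or HC_AV.
-/

namespace Summit.Ventures.HSemireg.IndexRankDeterminant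

variable {k A : Type*} [CommRing k] [Ring A] [Algebra k A]

/-- **Determinant lemma (index rank ≤ 2 ⟹ T = 0).** If three triples `r, r′, r″ : Fin 3 → A` are spanned,
index-wise, by the same two vectors `a, b : Fin 3 → k` — `r_i = a_i • X + b_i • Y`, `r′_i = a_i • X′ + b_i • Y′`,
`r″_i = a_i • X″ + b_i • Y″` — then the fibre-test cubic form
`T(r,r′,r″) = r₀r′₁r″₂ − r₀r′₂r″₁ + r₁r′₂r″₀ − r₁r′₀r″₂ + r₂r′₀r″₁ − r₂r′₁r″₀` vanishes.
[TH3-UNIVERSAL §8, determinant lemma] -/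
theorem T3_eq_zero_of_index_rank_le_two (a b : Fin 3 → k) (X Y X' Y' X'' Y'' : A)
    (r r' r'' : Fin 3 → A) (hr : ∀ i, r i = a i • X + b i • Y) (hr' : ∀ i, r' i = a i • X' + b i • Y')
    (hr'' : ∀ i, r'' i = a i • X'' + b i • Y'') :
    r 0 * r' 1 * r'' 2 - r 0 * r' 2 * r'' 1 + r 1 * r' 2 * r'' 0
      - r 1 * r' 0 * r'' 2 + r 2 * r' 0 * r'' 1 - r 2 * r' 1 * r'' 0 = 0 := by
  simp only [hr, hr', hr'', add_mul, mul_add, smul_mul_assoc, mul_smul_comm]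
  module

/-- The index-rank-≤ 1 case (all three triples proportional to ONE index vector `a`): `T(r,r′,r″) = 0`. -/
theorem T3_eq_zero_of_index_rank_le_one (a : Fin 3 → k) (X X' X'' : A)
    (r r' r'' : Fin 3 → A) (hr : ∀ i, r i = a i • X) (hr' : ∀ i, r' i = a i • X') (hr'' : ∀ i, r'' i = a i • X'') :
    r 0 * r' 1 * r'' 2 - r 0 * r' 2 * r'' 1 + r 1 * r' 2 * r'' 0
      - r 1 * r' 0 * r'' 2 + r 2 * r' 0 * r'' 1 - r 2 * r' 1 * r'' 0 = 0 := by
  simp only [hr, hr', hr'', smul_mul_assoc, mul_smul_comm]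
  module

end Summit.Ventures.HSemireg.IndexRankDeterminant
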